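import Mathlib
import Summits.Ventures.HodgeRepro.Tier4.Common.AdelicDefs
import Summits.Ventures.HodgeRepro.Tier4.Common.MixedPlaneCusp
import Summits.Ventures.HodgeRepro.Tier4.LitCompactnessPlane
import Summits.Ventures.HodgeRepro.Tier4.Line1.RTFSetting
import Summits.Ventures.HodgeRepro.Tier4.Line1.RealisedSetting
import Summits.Ventures.HodgeRepro.Tier4.Line1.RealisedSettingAniso

/-!
# Tier4/Line4/SettingAniso — the three RealisedSetting bridges that t4-L1-p5's `RealisedSettingAniso` (p697782) lacks:
the toric functional, L1.1 and L1.2b on the ANISOTROPIC instance `Setting.ofAdelicAniso`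

Blind re-derivation cell `pub-hodge-repro`, Tier 4 (README §9–§10), seat t4-L1-p4 (gen 4), re-pointed by the lead
(R-7 S14714, R-11 S14775) to LINE L4; C-L4-ANISO-SETTING (a) closed by the lead's word on p5's module, this file adds
ONLY what the RealisedSetting L68–L120 bridge list still lacked there.  Target tree path
`lean/Summits/Ventures/HodgeRepro/Tier4/Line4/SettingAniso.lean`.  Imports t4-L1-p5's RealisedSettingAniso
(`Setting.ofAdelicAniso`, `isCharacter_ofAdelicAniso`, `isCharacter'_ofAdelicAniso`, consumed BY NAME), t4-L1-p3's
RealisedSetting (`isTest_iff`, setting-independent).  The printed input `hp` (lit-3's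
`Lit.BorelHarishChandra1962_Thm11_8_cocompact_plane_aniso`, p696518) is displayed through p5's definition; nothing
printed is consumed here.

WHAT IS PROVED.  `periodT_ofAdelicAniso` (the generic `χ`-functional on the anisotropic instance IS typer-2's
`toricPeriod` against `conj χ`), `rtf_geometric_adelicAniso` (L1.1: `J(f) = ∑ᶠ o, O_o(f)` for `IsTestFn f`) and
`rtf_spectral_adelicAniso` (L1.2b: the spectral expansion of `J(f₁ ⋆ f₂)`), each the twin of RealisedSetting's theorem
with `ofAdelic W hW hg ↦ ofAdelicAniso W hp hg hA`, from the generic lemmas.  `isTest_iff` is setting-independent and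
stays p3's.  Nothing here says anything about the status of the Hodge conjecture for CM abelian varieties, which is NOT
proved (HC_CM is NOT proved by anyone in this repository).
-/

set_option autoImplicit false

noncomputable section

namespace Summit.Ventures.HodgeRepro.Tier4.Line1

open NumberField Common MeasureTheory Topology

section Instance

variable {k : Type} [Field k] [NumberField k] (W : PlaneData k) [MeasurableSpace (GA W)] [BorelSpace (GA W)]
  (hp : Lit.BorelHarishChandra1962_Thm11_8_cocompact_plane_aniso W) (hg : IsGenuineRow W)
  (hA : IsAnisotropic W) (R : RTFData W) (μ : Measure (GA W)) [μ.IsHaarMeasure]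
  [R.μT.IsHaarMeasure] [R.μT'.IsHaarMeasure] (hT : IsCompact (closure R.DT))
  (hT' : IsCompact (closure R.DT'))

/-- bridge (PROVED): the generic `χ`-functional on the anisotropic instance IS typer-2's `toricPeriod` against
`conj χ`. -/
theorem periodT_ofAdelicAniso (χ a : torusT W → ℂ) :
    (Setting.ofAdelicAniso W hp hg hA R μ hT hT').periodT χ a =
      Common.toricPeriod W R.μT R.DT (fun t => starRingEnd ℂ (χ t)) a := by
  unfold RTF.Setting.periodT Common.toricPeriod
  exact MeasureTheory.integral_congr_ae (Filter.Eventually.of_forall fun t => mul_comm _ _)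

/-- instance corollary of L1.1 on the anisotropic plane (PROVED from the generic lemma): the relative trace formula
distribution of the face is the finite sum of the rational double-coset terms. -/
theorem rtf_geometric_adelicAniso (hc : Continuous R.chi) (hu : ∀ a, ‖R.chi a‖ = 1) (hc' : Continuous R.chi')
    (hu' : ∀ a, ‖R.chi' a‖ = 1) {f : GA W → ℂ} (hf : Common.IsTestFn W f) :
    (Setting.ofAdelicAniso W hp hg hA R μ hT hT').J R.chi R.chi' f =
      ∑ᶠ o, (Setting.ofAdelicAniso W hp hg hA R μ hT hT').orbital R.chi R.chi' o f :=
  (Setting.ofAdelicAniso W hp hg hA R μ hT hT').rtf_geometric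
    (isCharacter_ofAdelicAniso W hp hg hA R μ hT hT' hc hu)
    (isCharacter'_ofAdelicAniso W hp hg hA R μ hT hT' hc' hu') ((isTest_iff W f).mpr hf)

/-- instance corollary of L1.2b on the anisotropic plane (PROVED from the generic lemma): the spectral expansion of
`J(f₁ ⋆ f₂)` on `[U(W)]`. -/
theorem rtf_spectral_adelicAniso (hc : Continuous R.chi) (hu : ∀ a, ‖R.chi a‖ = 1) (hc' : Continuous R.chi')
    (hu' : ∀ a, ‖R.chi' a‖ = 1) {τ : ℕ → Set (GA W → ℂ)} {φ : ℕ → GA W → ℂ} {n : ℕ → ℕ}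
    (hB : (Setting.ofAdelicAniso W hp hg hA R μ hT hT').IsAdaptedONB τ φ n) {f₁ f₂ : GA W → ℂ}
    (h₁ : Common.IsTestFn W f₁) (h₂ : Common.IsTestFn W f₂) :
    HasSum (fun j => (Setting.ofAdelicAniso W hp hg hA R μ hT hT').periodT' R.chi'
        (fun t' => (Setting.ofAdelicAniso W hp hg hA R μ hT hT').R (RTF.refl f₂) (φ j) t') *
      starRingEnd ℂ ((Setting.ofAdelicAniso W hp hg hA R μ hT hT').periodT R.chi
        (fun t => (Setting.ofAdelicAniso W hp hg hA R μ hT hT').R (RTF.cj f₁) (φ j) t)))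
      ((Setting.ofAdelicAniso W hp hg hA R μ hT hT').J R.chi R.chi'
        ((Setting.ofAdelicAniso W hp hg hA R μ hT hT').conv f₁ f₂)) :=
  (Setting.ofAdelicAniso W hp hg hA R μ hT hT').rtf_spectral
    (isCharacter_ofAdelicAniso W hp hg hA R μ hT hT' hc hu)
    (isCharacter'_ofAdelicAniso W hp hg hA R μ hT hT' hc' hu') hB ((isTest_iff W f₁).mpr h₁)
    ((isTest_iff W f₂).mpr h₂)

end Instance

end Summit.Ventures.HodgeRepro.Tier4.Line1

end
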